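import Summits.FinalStateConjecture.FinalStateConjecture.Theorems.EIHFluxBalanceInertialRecessionLorentz

/-!
# Route EIHFluxBalance — `InertialRecession` (E′), stub `stub_frozenVacuumSlaving`:
# the set of Lorentz operators with bounded Lorentz factor is compact

Helper file for the crux `stmt-FinalStateConjecture-17403`
(`Summit.FinalStateConjecture.FinalStateConjecture.Theses.EIHFluxBalance.InertialRecession`, E′),
stub `stub_frozenVacuumSlaving`, roadmap `FVS_momentum_roadmap.md` steps (P5)/(P6) (uniformity of
the coercivity constants over the painted boosts): the compactness input of
`exists_bound_of_forall_injective` (`…StubSlaving11JetAbsorb`) for families parametrised by the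
boost. The painted Lorentz maps of the crux satisfy `|(Λe₀)⁰| ≤ γ`; as operators on `E4` they range
in the set of `η`-isometries with that bound, which is closed (pointwise closed conditions) and
bounded (`‖Λ‖ ≤ 1 + 3|(Λe₀)⁰|`, `norm_lorentz_le`), hence compact in the finite-dimensional operator
space.

* `injective_of_minkowski_isometry` — an `η`-isometric operator is injective (nondegeneracy of
  `η`), hence an element of `lorentzGroup` (used to transfer `norm_lorentz_le`);
* `isClosed_lorentzBounded`, `isBounded_lorentzBounded`, `isCompact_lorentzBounded` — the set
  `{L | ∀ v w, η(Lv, Lw) = η(v, w), |(L e₀)⁰| ≤ γ}` is closed, bounded, **compact**;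
* `mem_lorentzBounded` — the painted maps of the crux lie in it.

Elementary; no definitions, no named facts, no `sorry`.
-/

set_option linter.dupNamespace false

noncomputable section

open Set Function Metric Literature.Geometry.Lorentzian
  Summit.FinalStateConjecture.FinalStateConjecture.Theorems

namespace Summit.FinalStateConjecture.FinalStateConjecture.Theorems.SublinearIsFree.Slaving

/-- **An `η`-isometric operator of `E4` is injective** (nondegeneracy of `η`,
`Minkowski.bilin_nondegenerate`). [cite: ONeill1983, Ch. 9, p. 233] -/
theorem injective_of_minkowski_isometry {L : E4 →L[ℝ] E4}
    (hL : ∀ v w, Minkowski.bilin (L v) (L w) = Minkowski.bilin v w) : Injective L := by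
  intro v w hvw
  have h : ∀ z, Minkowski.bilin (v - w) z = 0 := by
    intro z
    rw [← hL, map_sub, hvw, sub_self, map_zero, zero_apply]
  exact sub_eq_zero.1 (Minkowski.bilin_nondegenerate _ h)

/-- **Closedness**: `{L | ∀ v w, η(Lv,Lw) = η(v,w), |(Le₀)⁰| ≤ γ}` is closed in `E4 →L E4` (pointwise
closed conditions under the continuous evaluations `L ↦ L v`). [folklore] -/
theorem isClosed_lorentzBounded (γ : ℝ) :
    IsClosed {L : E4 →L[ℝ] E4 | (∀ v w, Minkowski.bilin (L v) (L w) = Minkowski.bilin v w) ∧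
      |L (E4.basisVector 0) 0| ≤ γ} := by
  have h1 : IsClosed {L : E4 →L[ℝ] E4 | ∀ v w, Minkowski.bilin (L v) (L w) = Minkowski.bilin v w} := by
    have hset : {L : E4 →L[ℝ] E4 | ∀ v w, Minkowski.bilin (L v) (L w) = Minkowski.bilin v w} =
        ⋂ v : E4, ⋂ w : E4, {L : E4 →L[ℝ] E4 | Minkowski.bilin (L v) (L w) = Minkowski.bilin v w} := by
      ext L
      simp only [Set.mem_setOf_eq, Set.mem_iInter]
    rw [hset]
    refine isClosed_iInter fun v ↦ isClosed_iInter fun w ↦ ?_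
    have hv : Continuous fun L : E4 →L[ℝ] E4 ↦ L v := continuous_id.clm_apply continuous_const
    have hw : Continuous fun L : E4 →L[ℝ] E4 ↦ L w := continuous_id.clm_apply continuous_const
    have hc : Continuous fun L : E4 →L[ℝ] E4 ↦ Minkowski.bilin (L v) (L w) :=
      ((Minkowski.bilin : E4 →L[ℝ] E4 →L[ℝ] ℝ).continuous.comp hv).clm_apply hw
    exact isClosed_eq hc continuous_const
  have h2 : IsClosed {L : E4 →L[ℝ] E4 | |L (E4.basisVector 0) 0| ≤ γ} := by
    have h0 : Continuous fun L : E4 →L[ℝ] E4 ↦ L (E4.basisVector 0) :=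
      continuous_id.clm_apply continuous_const
    have h0' : Continuous fun L : E4 →L[ℝ] E4 ↦ L (E4.basisVector 0) 0 :=
      (EuclideanSpace.proj (0 : Fin 4)).continuous.comp h0
    exact isClosed_le (continuous_abs.comp h0') continuous_const
  have hset2 : {L : E4 →L[ℝ] E4 | (∀ v w, Minkowski.bilin (L v) (L w) = Minkowski.bilin v w) ∧
      |L (E4.basisVector 0) 0| ≤ γ} = {L : E4 →L[ℝ] E4 | ∀ v w, Minkowski.bilin (L v) (L w) =
      Minkowski.bilin v w} ∩ {L : E4 →L[ℝ] E4 | |L (E4.basisVector 0) 0| ≤ γ} := by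
    ext L; simp only [Set.mem_setOf_eq, Set.mem_inter_iff]
  rw [hset2]
  exact h1.inter h2

/-- **Boundedness**: on that set `‖L‖ ≤ 1 + 3γ` (`norm_lorentz_le`, transferred through
`lorentzOfIsometry`). [cite: ONeill1983, Ch. 9, p. 236] -/
theorem isBounded_lorentzBounded (γ : ℝ) :
    Bornology.IsBounded {L : E4 →L[ℝ] E4 | (∀ v w, Minkowski.bilin (L v) (L w) = Minkowski.bilin v w) ∧
      |L (E4.basisVector 0) 0| ≤ γ} := by
  refine (Metric.isBounded_closedBall (x := (0 : E4 →L[ℝ] E4)) (r := 1 + 3 * γ)).subset ?_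
  rintro L ⟨hL, hγ⟩
  rw [mem_closedBall_zero_iff]
  -- `L` is an element of the Lorentz group (injective endomorphism ⇒ equivalence)
  let Λ : lorentzGroup := ⟨LinearEquiv.toContinuousLinearEquiv
      (LinearEquiv.ofInjectiveEndo (L : E4 →ₗ[ℝ] E4) (injective_of_minkowski_isometry hL)),
    fun v w ↦ hL v w⟩
  have h := norm_lorentz_le Λ
  have hcoe : (((Λ : lorentzGroup) : E4 ≃L[ℝ] E4) : E4 →L[ℝ] E4) = L := by
    ext v; rfl
  have hcoe0 : ((Λ : lorentzGroup) : E4 ≃L[ℝ] E4) (E4.basisVector 0) 0 = L (E4.basisVector 0) 0 := rfl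
  rw [hcoe, hcoe0] at h
  linarith

/-- **Compactness of the Lorentz operators with bounded Lorentz factor.** The set
`{L : E4 →L E4 | ∀ v w, η(Lv, Lw) = η(v, w), |(L e₀)⁰| ≤ γ}` is compact (closed and bounded in a
finite-dimensional normed space). This is the parameter set over which the coercivity constants of
the slaving analysis are made uniform (`exists_bound_of_forall_injective`). [cite: ONeill1983, Ch. 9, p. 236] -/
theorem isCompact_lorentzBounded (γ : ℝ) :
    IsCompact {L : E4 →L[ℝ] E4 | (∀ v w, Minkowski.bilin (L v) (L w) = Minkowski.bilin v w) ∧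
      |L (E4.basisVector 0) 0| ≤ γ} :=
  Metric.isCompact_of_isClosed_isBounded (isClosed_lorentzBounded γ) (isBounded_lorentzBounded γ)

/-- **The painted Lorentz maps of the crux lie in the compact set**: `Λ ∈ O(1,3)` with
`|(Λe₀)⁰| ≤ γ`. [folklore] -/
theorem mem_lorentzBounded {γ : ℝ} (Λ : lorentzGroup)
    (hγ : |((Λ : E4 ≃L[ℝ] E4) (E4.basisVector 0)) 0| ≤ γ) :
    ((Λ : E4 ≃L[ℝ] E4) : E4 →L[ℝ] E4) ∈ {L : E4 →L[ℝ] E4 |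
      (∀ v w, Minkowski.bilin (L v) (L w) = Minkowski.bilin v w) ∧ |L (E4.basisVector 0) 0| ≤ γ} :=
  ⟨fun v w ↦ Λ.2 v w, hγ⟩

/-- **Registered one-line carrier form** (`coer_isCompact_lorentzBounded_s0`) of
`isCompact_lorentzBounded`. [cite: ONeill1983, Ch. 9, p. 236] -/
theorem coer_isCompact_lorentzBounded_s0 : open Literature.Geometry.Lorentzian in ∀ (γ : ℝ), IsCompact {L : E4 →L[ℝ] E4 | (∀ v w, Minkowski.bilin (L v) (L w) = Minkowski.bilin v w) ∧ |L (E4.basisVector 0) 0| ≤ γ} :=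
  isCompact_lorentzBounded

end Summit.FinalStateConjecture.FinalStateConjecture.Theorems.SublinearIsFree.Slaving
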